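import Summits.HubbardSuperconductivity.HubbardLadder.Bounds.StiffnessFromEnergyBracketsTL
import HarnessLib

/-!
# Hubbard ladder — Bounds: the TIGHT chord hook (bounds.tex Thm 3♯, typed AND proved)
# — stiffness ceilings from certified energy brackets with the Hellmann–Feynman two-point form

HONEST FRAMING (cell pub-hubbard): ladder R1–R4 with certified numbers; no claim on H/H₀. These
are bounds for MODEL CLASSES (the square-lattice Hubbard torus `hubbardTorus 2 L 1 U`, resp. the
`t–t'` torus `hubbardTorusTT' L 1 t' U`, every filling, `U ≥ 0`; attractive twin `U ≤ 0`); no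
materials claim. Companion text: `pub-hubbard/paper/bounds.tex` §3 (Thm 3♯ = the sharpened form of
Thm 3 / SHARPENING #2); tables `pub-hubbard/pub-hubbard-bounds/BOUNDS.md` (row T3♯) and
`EXTREMISERS.md` §5a♯ (the certified column this file justifies, two implementations,
`code/bracket_hook_sharp_{A,B,compare}.py`, `code/table_hook_sharp.md`).

## What is sharpened, and why it is a theorem

The landed hook (`StiffnessFromEnergyBrackets*.lean`, Thm 3) bounds the kinetic energy of EVERY
ground state `ψ` of `H(1,U)` in a joint sector by `⟨-T⟩_ψ ≤ U (R - L₁)/(U - U₁) - Em` from THREE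
brackets `Em ≤ E(U) ≤ R`, `L₁ ≤ E(U₁)` (`U₁ < U`). The published argument is loose by exactly the
bracket width `R - Em`: the identity `⟨-T⟩_ψ = U D(ψ) - E(U)` and the chord (supergradient)
inequality `E(U₁) ≤ E(U) + (U₁ - U) D(ψ)` combine, for `U ≥ 0` and EVERY `U₁`, into the
**product form** `(U - U₁) ⟨-T⟩_ψ ≤ U₁ E(U) - U E(U₁)` (`sub_mul_two_mul_kinWeight_le`; equality
in the limit `U₁ → U` at points of differentiability = Hellmann–Feynman), in which `E(U)` enters
with the coefficient `U₁/(U - U₁) ≥ 0` only. Hence for `0 ≤ U₁ < U` and brackets `E(U) ≤ R`,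
`L₁ ≤ E(U₁)` (NO lower bracket at `U` needed):
`⟨-T⟩_ψ ≤ (U₁ R - U L₁)/(U - U₁) = [U (R - L₁)/(U - U₁) - Em] - (R - Em)`
(`two_mul_kinWeight_le_of_energyBrackets_sharp`, `chordSharp_eq`, `chordSharp_le_chord`).

## What is proved (no `sorry`, no new axioms; everything over the landed parts 1–3)

* `sub_mul_two_mul_kinWeight_le` / `…_attractive` / `…TT'` — the product form, all `U₁`.
* `StiffnessCeilingFromEnergyBracketsSharp` (`@[conjecture] def`, PROVED by `…_holds`): `L ≥ 3`,
  `δ ≥ -1`, `0 ≤ U₁ < U`, a flux stiffness `ρ_s θ² ≤ E_L(θ) - E_L(0)` (`|θ| ≤ θ₀`) of the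
  `(N_L, S^z = 0)` sector obeys `ρ_s L² ≤ ((U₁ R - U L₁)/(U - U₁))/4` for ALL `E_L(U;0) ≤ R`,
  `L₁ ≤ E_L(U₁;0)`; `…SharpTT'` the `t–t'` class (`+ t' (R - L₃)/(t₃ - t')`, unchanged);
  `StiffnessCeilingFromEnergyDensityBracketsSharp[TT']` the thermodynamic limit
  (`ρ_s ≤ ((U₁ r - U l₁)/(U - U₁) [+ t' (r - l₃)/(t₃ - t')])/4`);
  `stiffnessCeilingFromEnergyDensityBrackets_of_sharp`: the sharp TL node implies the landed one.
* `KineticBracketFromEnergyBracketsSharp` (`@[conjecture] def`, PROVED): the three tight kinetic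
  brackets (nearest-neighbour, `t–t'`, attractive) for every ground state.
* Part 2 = `StiffnessCeilingSharpInstances.lean`: the kernel-only instances (half filling `U = 8, 12`
  with the tree's Langer–Mattis rows; the Mott window Thm 7(v♯)(vi♯) `≈ 7 t²/U`, `ρ_s ≤ 0.4` at
  `U = 14`; the attractive class Thm 8♯ `ρ_s ≤ 8 t²/|U|`).

NUMBERS (certified column, EXTREMISERS.md §5a♯; inputs = the typed TL rows of the tree + BRACKETS.md,
NOT kernel theorems; 381 numbers agree between two implementations): thermodynamic limit, `t' = 0`,
best `U₁` — `n = 1`: `U = 6: 0.38945`, `U = 8: 0.35524`, `U = 12: 0.28673` (landed column `0.42568`,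
`0.38440`, `0.30952`; one-body `0.40528`); `n = 7/8`: `U = 8: 0.39206`, `U = 12: 0.36941` (landed
`0.46449`, `0.44829`; one-body `0.40194`) — five TL points below the one-body ceiling (landed: two).
Finite tori and the `t' = -1/5` rows stay above it (`0.53–1.08`).

References (`lean/references.bib`): KomaTasaki1994 §1; HazraVermaRanderia2019 eqs. (2)–(6), App. G;
ScalapinoWhiteZhang1993 §II; ParamekantiTrivediRanderia1998 eq. (3); LangerMattis1971 eqs. (3)–(5); LiebPRL1989.
-/

noncomputable section

namespace Summit.HubbardSuperconductivity.HubbardLadder.Bounds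

open Matrix Finset Real Filter Topology
open Literature.MathematicalPhysics.QuantumLattice
open Literature.MathematicalPhysics.QuantumFieldTheory
open Literature.Probability.LatticeModels
open Literature.MathematicalPhysics.QuantumLattice.LangerMattis
open Literature.MathematicalPhysics.QuantumLattice.ThermodynamicLimit
open scoped ComplexOrder ComplexConjugate Topology

variable {L : ℕ} [NeZero L]

/-! ### Algebra of the tight chord -/

/-- The tight chord value: `(U₁ R - U L₁)/(U - U₁) = U (R - L₁)/(U - U₁) - R`. -/
theorem chordSharp_eq {U U₁ : ℝ} (hU₁ : U₁ ≠ U) (R L₁ : ℝ) :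
    (U₁ * R - U * L₁) / (U - U₁) = U * ((R - L₁) / (U - U₁)) - R := by
  have hd : U - U₁ ≠ 0 := sub_ne_zero.2 (Ne.symm hU₁)
  field_simp
  ring

/-- The tight chord lies below the landed three-bracket chord by exactly `R - Em ≥ 0`. -/
theorem chordSharp_le_chord {U U₁ : ℝ} (hU₁ : U₁ ≠ U) {Em R : ℝ} (hEm : Em ≤ R) (L₁ : ℝ) :
    (U₁ * R - U * L₁) / (U - U₁) ≤ U * ((R - L₁) / (U - U₁)) - Em := by
  rw [chordSharp_eq hU₁]
  linarith

/-- Monotonicity of the tight chord in the brackets (`0 ≤ U₁ < U`). -/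
theorem chordSharp_mono {U U₁ E E₁ R L₁ : ℝ} (hU₁ : 0 ≤ U₁) (hU : U₁ < U) (hR : E ≤ R)
    (hL₁ : L₁ ≤ E₁) : (U₁ * E - U * E₁) / (U - U₁) ≤ (U₁ * R - U * L₁) / (U - U₁) := by
  have hU0 : 0 ≤ U := hU₁.trans hU.le
  have h1 := mul_le_mul_of_nonneg_left hR hU₁
  have h2 := mul_le_mul_of_nonneg_left hL₁ hU0
  exact div_le_div_of_nonneg_right (by linarith) (sub_pos.2 hU).le

/-! ### The product form (Hellmann–Feynman two-point inequality) for every ground state -/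

/-- **Product form, repulsive side** (`U ≥ 0`, EVERY `U₁`): a unit ground state `ψ` of `H(1,U)` in
the joint sector `(N, S^z = M)` has `(U - U₁) ⟨-T⟩_ψ ≤ U₁ E(U) - U E(U₁)`
(`⟨-T⟩_ψ = 2(K_x + K_y)(ψ) = U D(ψ) - E(U)` and the chord `E(U₁) ≤ E(U) + (U₁ - U) D(ψ)`). -/
theorem sub_mul_two_mul_kinWeight_le (hL : 3 ≤ L) {U : ℝ} (hU : 0 ≤ U) (U₁ : ℝ) {N : ℕ} {M : ℝ}
    {ψ : Fock (Orb (FermionTorus 2 L))} (hgs : IsGroundStateInSector (hubbardTorus 2 L 1 U) N M ψ)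
    (h1 : star ψ ⬝ᵥ ψ = 1) :
    (U - U₁) * (2 * (kinWeightDir 0 ψ + kinWeightDir 1 ψ)) ≤
      U₁ * sectorEnergy L U N M - U * sectorEnergy L U₁ N M := by
  have hkin : 2 * (kinWeightDir 0 ψ + kinWeightDir 1 ψ) =
      U * doubleOccExp ψ - sectorEnergy L U N M := by
    have h := re_expect_hubbardTorus_eq_kin hL U ψ
    rw [re_expect_eq_sectorEnergy hgs h1] at h
    linarith
  have hch := mul_le_mul_of_nonneg_left (sectorEnergy_le_add_mul_doubleOccExp hgs h1 U₁) hU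
  have e : (U - U₁) * (U * doubleOccExp ψ - sectorEnergy L U N M) = U₁ * sectorEnergy L U N M -
      U * (sectorEnergy L U N M + (U₁ - U) * doubleOccExp ψ) := by
    ring
  rw [hkin, e]
  linarith

/-- **Product form, attractive side** (`U ≤ 0`, every `U₁`): `U₁ E(U) - U E(U₁) ≤ (U - U₁) ⟨-T⟩_ψ`. -/
theorem sub_mul_two_mul_kinWeight_le_attractive (hL : 3 ≤ L) {U : ℝ} (hU : U ≤ 0) (U₁ : ℝ)
    {N : ℕ} {M : ℝ} {ψ : Fock (Orb (FermionTorus 2 L))}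
    (hgs : IsGroundStateInSector (hubbardTorus 2 L 1 U) N M ψ) (h1 : star ψ ⬝ᵥ ψ = 1) :
    U₁ * sectorEnergy L U N M - U * sectorEnergy L U₁ N M ≤
      (U - U₁) * (2 * (kinWeightDir 0 ψ + kinWeightDir 1 ψ)) := by
  have hkin : 2 * (kinWeightDir 0 ψ + kinWeightDir 1 ψ) =
      U * doubleOccExp ψ - sectorEnergy L U N M := by
    have h := re_expect_hubbardTorus_eq_kin hL U ψ
    rw [re_expect_eq_sectorEnergy hgs h1] at h
    linarith
  have hch := mul_le_mul_of_nonpos_left (sectorEnergy_le_add_mul_doubleOccExp hgs h1 U₁) hU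
  have e : (U - U₁) * (U * doubleOccExp ψ - sectorEnergy L U N M) = U₁ * sectorEnergy L U N M -
      U * (sectorEnergy L U N M + (U₁ - U) * doubleOccExp ψ) := by
    ring
  rw [hkin, e]
  linarith

/-- **Product form, `t–t'` class** (`U ≥ 0`, every `U₁`, same `t'`):
`(U - U₁) · 2(K_x + K_y + t' K_d)(ψ) ≤ U₁ E^{tt'}(U) - U E^{tt'}(U₁)`. -/
theorem sub_mul_two_mul_kinWeightTT'_le (hL : 3 ≤ L) {t' U : ℝ} (hU : 0 ≤ U) (U₁ : ℝ) {N : ℕ}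
    {M : ℝ} {ψ : Fock (Orb (FermionTorus 2 L))}
    (hgs : IsGroundStateInSector (hubbardTorusTT' L 1 t' U) N M ψ) (h1 : star ψ ⬝ᵥ ψ = 1) :
    (U - U₁) * (2 * (kinWeightDir 0 ψ + kinWeightDir 1 ψ + t' * kinWeightDiag ψ)) ≤
      U₁ * sectorEnergyTT' L t' U N M - U * sectorEnergyTT' L t' U₁ N M := by
  have hkin : 2 * (kinWeightDir 0 ψ + kinWeightDir 1 ψ + t' * kinWeightDiag ψ) =
      U * doubleOccExp ψ - sectorEnergyTT' L t' U N M := by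
    have h := re_expect_hubbardTorusTT'_eq_kin hL t' U ψ
    rw [re_expect_eq_sectorEnergyTT' hgs h1] at h
    linarith
  have hch := mul_le_mul_of_nonneg_left (sectorEnergyTT'_le_add_mul_doubleOccExp hgs h1 U₁) hU
  have e : (U - U₁) * (U * doubleOccExp ψ - sectorEnergyTT' L t' U N M) =
      U₁ * sectorEnergyTT' L t' U N M -
        U * (sectorEnergyTT' L t' U N M + (U₁ - U) * doubleOccExp ψ) := by
    ring
  rw [hkin, e]
  linarith

/-! ### Tight kinetic brackets (bounds.tex Thm 3♯(i)) -/

/-- **Tight upper kinetic bracket** (`0 ≤ U₁ < U`; brackets `E(U) ≤ R`, `L₁ ≤ E(U₁)` only):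
`⟨-T⟩_ψ = 2(K_x + K_y)(ψ) ≤ (U₁ R - U L₁)/(U - U₁)`. -/
theorem two_mul_kinWeight_le_of_energyBrackets_sharp (hL : 3 ≤ L) {U U₁ : ℝ} (hU₁0 : 0 ≤ U₁)
    (hU₁ : U₁ < U) {N : ℕ} {M : ℝ} {ψ : Fock (Orb (FermionTorus 2 L))}
    (hgs : IsGroundStateInSector (hubbardTorus 2 L 1 U) N M ψ) (h1 : star ψ ⬝ᵥ ψ = 1)
    {R L₁ : ℝ} (hR : sectorEnergy L U N M ≤ R) (hL₁ : L₁ ≤ sectorEnergy L U₁ N M) :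
    2 * (kinWeightDir 0 ψ + kinWeightDir 1 ψ) ≤ (U₁ * R - U * L₁) / (U - U₁) := by
  have hU : 0 ≤ U := hU₁0.trans hU₁.le
  have h := sub_mul_two_mul_kinWeight_le hL hU U₁ hgs h1
  have hR' := mul_le_mul_of_nonneg_left hR hU₁0
  have hL' := mul_le_mul_of_nonneg_left hL₁ hU
  rw [le_div_iff₀ (sub_pos.2 hU₁)]
  linarith

/-- **Tight upper kinetic bracket, `t–t'` class** (`0 ≤ U₁ < U`):
`2(K_x + K_y + t' K_d)(ψ) ≤ (U₁ R - U L₁)/(U - U₁)` from `E^{tt'}(U) ≤ R`, `L₁ ≤ E^{tt'}(U₁)`. -/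
theorem two_mul_kinWeightTT'_le_of_energyBrackets_sharp (hL : 3 ≤ L) {t' U U₁ : ℝ}
    (hU₁0 : 0 ≤ U₁) (hU₁ : U₁ < U) {N : ℕ} {M : ℝ} {ψ : Fock (Orb (FermionTorus 2 L))}
    (hgs : IsGroundStateInSector (hubbardTorusTT' L 1 t' U) N M ψ) (h1 : star ψ ⬝ᵥ ψ = 1)
    {R L₁ : ℝ} (hR : sectorEnergyTT' L t' U N M ≤ R) (hL₁ : L₁ ≤ sectorEnergyTT' L t' U₁ N M) :
    2 * (kinWeightDir 0 ψ + kinWeightDir 1 ψ + t' * kinWeightDiag ψ) ≤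
      (U₁ * R - U * L₁) / (U - U₁) := by
  have hU : 0 ≤ U := hU₁0.trans hU₁.le
  have h := sub_mul_two_mul_kinWeightTT'_le hL hU U₁ hgs h1 (t' := t')
  have hR' := mul_le_mul_of_nonneg_left hR hU₁0
  have hL' := mul_le_mul_of_nonneg_left hL₁ hU
  rw [le_div_iff₀ (sub_pos.2 hU₁)]
  linarith

/-- **Tight upper kinetic bracket, attractive side** (`U < U₁ ≤ 0`; `E(U) ≤ R`, `L₁ ≤ E(U₁)`):
`⟨-T⟩_ψ ≤ (U L₁ - U₁ R)/(U₁ - U)`. -/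
theorem two_mul_kinWeight_le_of_energyBrackets_attractive_sharp (hL : 3 ≤ L) {U U₁ : ℝ}
    (hU₁0 : U₁ ≤ 0) (hU₁ : U < U₁) {N : ℕ} {M : ℝ} {ψ : Fock (Orb (FermionTorus 2 L))}
    (hgs : IsGroundStateInSector (hubbardTorus 2 L 1 U) N M ψ) (h1 : star ψ ⬝ᵥ ψ = 1)
    {R L₁ : ℝ} (hR : sectorEnergy L U N M ≤ R) (hL₁ : L₁ ≤ sectorEnergy L U₁ N M) :
    2 * (kinWeightDir 0 ψ + kinWeightDir 1 ψ) ≤ (U * L₁ - U₁ * R) / (U₁ - U) := by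
  have hU : U ≤ 0 := hU₁.le.trans hU₁0
  have h := sub_mul_two_mul_kinWeight_le_attractive hL hU U₁ hgs h1
  have hR' := mul_le_mul_of_nonneg_left hR (neg_nonneg.2 hU₁0)
  have hL' := mul_le_mul_of_nonpos_left hL₁ hU
  rw [le_div_iff₀ (sub_pos.2 hU₁)]
  linarith

/-- **Tight kinetic brackets from energy brackets (bounds.tex Thm 3♯(i); PROVED below).** On the
`L × L` torus (`L ≥ 3`, `t = 1`), for EVERY unit ground state `ψ` of a joint sector `(N, S^z = M)`:
(a) `0 ≤ U₁ < U`, `E(U) ≤ R`, `L₁ ≤ E(U₁)` ⟹ `⟨-T⟩_ψ ≤ (U₁ R - U L₁)/(U - U₁)`;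
(b) the same for the `t–t'` class, `2(K_x + K_y + t' K_d)(ψ) ≤ (U₁ R - U L₁)/(U - U₁)`;
(c) attractive side `U < U₁ ≤ 0`: `⟨-T⟩_ψ ≤ (U L₁ - U₁ R)/(U₁ - U)`.
kind: support (PROVED). Why it might fail: it cannot. Sources: KomaTasaki1994 §1; this cell. -/
@[conjecture] def KineticBracketFromEnergyBracketsSharp : Prop :=
  (∀ (L : ℕ) [NeZero L], 3 ≤ L → ∀ (U U₁ : ℝ) (N : ℕ) (M : ℝ), 0 ≤ U₁ → U₁ < U →
    ∀ ψ : Fock (Orb (FermionTorus 2 L)), IsGroundStateInSector (hubbardTorus 2 L 1 U) N M ψ →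
      star ψ ⬝ᵥ ψ = 1 → ∀ (R L₁ : ℝ), sectorEnergy L U N M ≤ R → L₁ ≤ sectorEnergy L U₁ N M →
        2 * (kinWeightDir 0 ψ + kinWeightDir 1 ψ) ≤ (U₁ * R - U * L₁) / (U - U₁)) ∧
  (∀ (L : ℕ) [NeZero L], 3 ≤ L → ∀ (t' U U₁ : ℝ) (N : ℕ) (M : ℝ), 0 ≤ U₁ → U₁ < U →
    ∀ ψ : Fock (Orb (FermionTorus 2 L)), IsGroundStateInSector (hubbardTorusTT' L 1 t' U) N M ψ →
      star ψ ⬝ᵥ ψ = 1 → ∀ (R L₁ : ℝ), sectorEnergyTT' L t' U N M ≤ R →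
        L₁ ≤ sectorEnergyTT' L t' U₁ N M →
        2 * (kinWeightDir 0 ψ + kinWeightDir 1 ψ + t' * kinWeightDiag ψ) ≤
          (U₁ * R - U * L₁) / (U - U₁)) ∧
  (∀ (L : ℕ) [NeZero L], 3 ≤ L → ∀ (U U₁ : ℝ) (N : ℕ) (M : ℝ), U₁ ≤ 0 → U < U₁ →
    ∀ ψ : Fock (Orb (FermionTorus 2 L)), IsGroundStateInSector (hubbardTorus 2 L 1 U) N M ψ →
      star ψ ⬝ᵥ ψ = 1 → ∀ (R L₁ : ℝ), sectorEnergy L U N M ≤ R → L₁ ≤ sectorEnergy L U₁ N M →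
        2 * (kinWeightDir 0 ψ + kinWeightDir 1 ψ) ≤ (U * L₁ - U₁ * R) / (U₁ - U))

/-- **Proof of `KineticBracketFromEnergyBracketsSharp`.** -/
theorem kineticBracketFromEnergyBracketsSharp_holds : KineticBracketFromEnergyBracketsSharp :=
  ⟨fun _ _ hL _ _ _ _ hU₁0 hU₁ _ hgs h1 _ _ hR hL₁ =>
      two_mul_kinWeight_le_of_energyBrackets_sharp hL hU₁0 hU₁ hgs h1 hR hL₁,
    fun _ _ hL _ _ _ _ _ hU₁0 hU₁ _ hgs h1 _ _ hR hL₁ =>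
      two_mul_kinWeightTT'_le_of_energyBrackets_sharp hL hU₁0 hU₁ hgs h1 hR hL₁,
    fun _ _ hL _ _ _ _ hU₁0 hU₁ _ hgs h1 _ _ hR hL₁ =>
      two_mul_kinWeight_le_of_energyBrackets_attractive_sharp hL hU₁0 hU₁ hgs h1 hR hL₁⟩

/-! ### The tight certified-bracket stiffness ceiling, finite torus (bounds.tex Thm 3♯(ii)) -/

/-- **Tight certified-bracket stiffness ceiling, nearest-neighbour class (PROVED below).** `L ≥ 3`,
`δ ≥ -1`, `0 ≤ U₁ < U`: a flux stiffness `ρ_s > 0` of the `(N_L, S^z = 0)` sector of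
`hubbardTorus 2 L 1 U` (`ρ_s θ² ≤ E_L(θ) - E_L(0)`, `|θ| ≤ θ₀`) obeys, for ALL `E_L(U;0) ≤ R` and
`L₁ ≤ E_L(U₁;0)`: `ρ_s L² ≤ ((U₁ R - U L₁)/(U - U₁))/4`.
kind: support (PROVED). Why it might fail: it cannot. Sources: KomaTasaki1994 §1;
HazraVermaRanderia2019 App. G; this cell (bounds.tex Thm 3♯). -/
@[conjecture] def StiffnessCeilingFromEnergyBracketsSharp : Prop :=
  ∀ (L : ℕ) [NeZero L], 3 ≤ L → ∀ (U U₁ δ ρs θ₀ : ℝ), -1 ≤ δ → 0 ≤ U₁ → U₁ < U → 0 < ρs →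
    0 < θ₀ → (∀ θ : ℝ, |θ| ≤ θ₀ → ρs * θ ^ 2 ≤ fluxEnergy L U δ θ - fluxEnergy L U δ 0) →
    ∀ (R L₁ : ℝ), fluxEnergy L U δ 0 ≤ R → L₁ ≤ fluxEnergy L U₁ δ 0 →
      ρs * (L : ℝ) ^ 2 ≤ ((U₁ * R - U * L₁) / (U - U₁)) / 4

/-- **Proof**: the landed node with `Em = R = E_L(U;0)` (exact) is the tight chord at the exact
energy; then monotonicity in `R` (coefficient `U₁/(U - U₁) ≥ 0`). -/
theorem stiffnessCeilingFromEnergyBracketsSharp_holds : StiffnessCeilingFromEnergyBracketsSharp := by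
  intro L _ hL U U₁ δ ρs θ₀ hδ hU₁0 hU₁ hρs hθ₀ hst R L₁ hR hL₁
  have hU : 0 ≤ U := hU₁0.trans hU₁.le
  have h := stiffnessCeilingFromEnergyBrackets_holds L hL U U₁ δ ρs θ₀ hδ hU hU₁ hρs hθ₀ hst
    (fluxEnergy L U δ 0) (fluxEnergy L U δ 0) L₁ le_rfl le_rfl hL₁
  rw [← chordSharp_eq hU₁.ne (fluxEnergy L U δ 0) L₁] at h
  have hm := chordSharp_mono hU₁0 hU₁ hR (le_refl L₁)
  linarith

/-- **Tight ceiling, `t–t'` class, `t' ≤ 0` (PROVED below)**: as `StiffnessCeilingFromEnergyBracketsTT'`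
with the `U`-chord term replaced by the tight chord:
`ρ_s L² ≤ ((U₁ R - U L₁)/(U - U₁) + t' (R - L₃)/(t₃ - t'))/4`.
kind: support (PROVED). Why it might fail: it cannot. Sources: as the `t' = 0` node. -/
@[conjecture] def StiffnessCeilingFromEnergyBracketsSharpTT' : Prop :=
  ∀ (L : ℕ) [NeZero L], 3 ≤ L → ∀ (t' t₃ U U₁ δ ρs θ₀ : ℝ), -1 ≤ δ → t' ≤ 0 → t₃ < t' → 0 ≤ U₁ →
    U₁ < U → 0 < ρs → 0 < θ₀ →
    (∀ θ : ℝ, |θ| ≤ θ₀ → ρs * θ ^ 2 ≤ fluxEnergyTT' L t' U δ θ - fluxEnergyTT' L t' U δ 0) →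
    ∀ (R L₁ L₃ : ℝ), fluxEnergyTT' L t' U δ 0 ≤ R → L₁ ≤ fluxEnergyTT' L t' U₁ δ 0 →
      L₃ ≤ fluxEnergyTT' L t₃ U δ 0 →
      ρs * (L : ℝ) ^ 2 ≤ ((U₁ * R - U * L₁) / (U - U₁) + t' * ((R - L₃) / (t₃ - t'))) / 4

/-- **Proof of `StiffnessCeilingFromEnergyBracketsSharpTT'`.** -/
theorem stiffnessCeilingFromEnergyBracketsSharpTT'_holds :
    StiffnessCeilingFromEnergyBracketsSharpTT' := by
  intro L _ hL t' t₃ U U₁ δ ρs θ₀ hδ ht' ht₃ hU₁0 hU₁ hρs hθ₀ hst R L₁ L₃ hR hL₁ hL₃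
  have hU : 0 ≤ U := hU₁0.trans hU₁.le
  have h := stiffnessCeilingFromEnergyBracketsTT'_holds L hL t' t₃ U U₁ δ ρs θ₀ hδ ht' ht₃ hU hU₁
    hρs hθ₀ hst (fluxEnergyTT' L t' U δ 0) (fluxEnergyTT' L t' U δ 0) L₁ L₃ le_rfl le_rfl hL₁ hL₃
  rw [← chordSharp_eq hU₁.ne (fluxEnergyTT' L t' U δ 0) L₁] at h
  have hm := chordSharp_mono hU₁0 hU₁ hR (le_refl L₁)
  have hq : (R - L₃) / (t₃ - t') ≤ (fluxEnergyTT' L t' U δ 0 - L₃) / (t₃ - t') :=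
    div_le_div_of_nonpos_of_le (by linarith) (by linarith)
  have htq := mul_le_mul_of_nonpos_left hq ht'
  linarith

/-- Consistency at `t' = 0`: the tight `t–t'` ceiling specialises to the tight nearest-neighbour one. -/
theorem stiffnessCeilingFromEnergyBracketsSharp_of_TT' (h : StiffnessCeilingFromEnergyBracketsSharpTT') :
    StiffnessCeilingFromEnergyBracketsSharp := by
  intro L _ hL U U₁ δ ρs θ₀ hδ hU₁0 hU₁ hρs hθ₀ hst R L₁ hR hL₁
  have h' := h L hL 0 (-1) U U₁ δ ρs θ₀ hδ le_rfl (by norm_num) hU₁0 hU₁ hρs hθ₀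
    (by simpa only [fluxEnergyTT'_tPrime_zero] using hst) R L₁ (fluxEnergyTT' L (-1) U δ 0)
    (by simpa only [fluxEnergyTT'_tPrime_zero] using hR)
    (by simpa only [fluxEnergyTT'_tPrime_zero] using hL₁) le_rfl
  linarith

/-! ### Thermodynamic limit (bounds.tex Thm 3♯(iii)) -/

/-- **Tight thermodynamic-limit ceiling** (`0 ≤ U₁ < U`, `-1 < δ ≤ 1`): a stiffness constant valid
along all even `L ≥ L₀` obeys `ρ_s ≤ ((U₁ r - U l₁)/(U - U₁))/4` for all `e(U) ≤ r`, `l₁ ≤ e(U₁)`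
(`e(·) = energyDensity2D 1 · (1 - δ)`). -/
theorem stiffness_le_of_energyDensityBrackets_sharp {U U₁ δ ρs θ₀ : ℝ} (hU₁ : 0 ≤ U₁)
    (hU : U₁ < U) (hδ1 : -1 < δ) (hδ2 : δ ≤ 1) (hρs : 0 < ρs) (hθ₀ : 0 < θ₀) {L₀ : ℕ}
    (hst : ∀ (L : ℕ) [NeZero L], L₀ ≤ L → Even L →
      ∀ θ : ℝ, |θ| ≤ θ₀ → ρs * θ ^ 2 ≤ fluxEnergy L U δ θ - fluxEnergy L U δ 0)
    {r l₁ : ℝ} (hr : energyDensity2D 1 U (1 - δ) ≤ r) (hl₁ : l₁ ≤ energyDensity2D 1 U₁ (1 - δ)) :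
    ρs ≤ ((U₁ * r - U * l₁) / (U - U₁)) / 4 := by
  have h := stiffness_le_of_energyDensity_slope hU₁ hU hδ1 hδ2 hρs hθ₀ hst
  rw [← chordSharp_eq hU.ne (energyDensity2D 1 U (1 - δ)) (energyDensity2D 1 U₁ (1 - δ))] at h
  have hm := chordSharp_mono hU₁ hU hr hl₁
  linarith

/-- **Tight thermodynamic-limit certified-bracket stiffness ceiling (PROVED below).**
kind: support (PROVED). Why it might fail: it cannot. Sources: as the finite node; Ruelle 1969 §3.3. -/
@[conjecture] def StiffnessCeilingFromEnergyDensityBracketsSharp : Prop :=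
  ∀ (U U₁ δ ρs θ₀ : ℝ), 0 ≤ U₁ → U₁ < U → -1 < δ → δ ≤ 1 → 0 < ρs → 0 < θ₀ →
    (∃ L₀ : ℕ, ∀ (L : ℕ) [NeZero L], L₀ ≤ L → Even L →
      ∀ θ : ℝ, |θ| ≤ θ₀ → ρs * θ ^ 2 ≤ fluxEnergy L U δ θ - fluxEnergy L U δ 0) →
    ∀ (r l₁ : ℝ), energyDensity2D 1 U (1 - δ) ≤ r → l₁ ≤ energyDensity2D 1 U₁ (1 - δ) →
      ρs ≤ ((U₁ * r - U * l₁) / (U - U₁)) / 4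

/-- **Proof of `StiffnessCeilingFromEnergyDensityBracketsSharp`.** -/
theorem stiffnessCeilingFromEnergyDensityBracketsSharp_holds : StiffnessCeilingFromEnergyDensityBracketsSharp := by
  intro U U₁ δ ρs θ₀ hU₁ hU hδ1 hδ2 hρs hθ₀ hst r l₁ hr hl₁
  obtain ⟨L₀, hst⟩ := hst
  exact stiffness_le_of_energyDensityBrackets_sharp hU₁ hU hδ1 hδ2 hρs hθ₀ hst hr hl₁

/-- The tight TL node implies the landed one (`chordSharp_le_chord`). -/
theorem stiffnessCeilingFromEnergyDensityBrackets_of_sharp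
    (h : StiffnessCeilingFromEnergyDensityBracketsSharp) : StiffnessCeilingFromEnergyDensityBrackets := by
  intro U U₁ δ ρs θ₀ hU₁ hU hδ1 hδ2 hρs hθ₀ hst em r l₁ hem hr hl₁
  have h' := h U U₁ δ ρs θ₀ hU₁ hU hδ1 hδ2 hρs hθ₀ hst r l₁ hr hl₁
  have hc := chordSharp_le_chord hU.ne (hem.trans hr) l₁ (U := U)
  linarith

/-- **Tight TL ceiling, `t–t'` class** (`t₃ < t' ≤ 0`, `0 ≤ U₁ < U`, `-1 < δ ≤ 1`):
`ρ_s ≤ ((U₁ r - U l₁)/(U - U₁) + t' (r - l₃)/(t₃ - t'))/4` from `e_{t'}(U) ≤ r`, `l₁ ≤ e_{t'}(U₁)`,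
`l₃ ≤ e_{t₃}(U)` (`e_s(V) = energyDensityTT' 1 s V (1 - δ)`). -/
theorem stiffnessTT'_le_of_energyDensityBrackets_sharp {t' t₃ U U₁ δ ρs θ₀ : ℝ} (ht' : t' ≤ 0)
    (ht₃ : t₃ < t') (hU₁ : 0 ≤ U₁) (hU : U₁ < U) (hδ1 : -1 < δ) (hδ2 : δ ≤ 1) (hρs : 0 < ρs)
    (hθ₀ : 0 < θ₀) {L₀ : ℕ}
    (hst : ∀ (L : ℕ) [NeZero L], L₀ ≤ L → Even L →
      ∀ θ : ℝ, |θ| ≤ θ₀ → ρs * θ ^ 2 ≤ fluxEnergyTT' L t' U δ θ - fluxEnergyTT' L t' U δ 0)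
    {r l₁ l₃ : ℝ} (hr : energyDensityTT' 1 t' U (1 - δ) ≤ r)
    (hl₁ : l₁ ≤ energyDensityTT' 1 t' U₁ (1 - δ)) (hl₃ : l₃ ≤ energyDensityTT' 1 t₃ U (1 - δ)) :
    ρs ≤ ((U₁ * r - U * l₁) / (U - U₁) + t' * ((r - l₃) / (t₃ - t'))) / 4 := by
  have h := stiffnessTT'_le_of_energyDensity_slope ht' ht₃ hU₁ hU hδ1 hδ2 hρs hθ₀ hst
  rw [← chordSharp_eq hU.ne (energyDensityTT' 1 t' U (1 - δ)) (energyDensityTT' 1 t' U₁ (1 - δ))] at h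
  have hm := chordSharp_mono hU₁ hU hr hl₁
  have hq : (r - l₃) / (t₃ - t') ≤
      (energyDensityTT' 1 t' U (1 - δ) - energyDensityTT' 1 t₃ U (1 - δ)) / (t₃ - t') :=
    div_le_div_of_nonpos_of_le (by linarith) (by linarith)
  have htq := mul_le_mul_of_nonpos_left hq ht'
  linarith

/-- **Tight TL certified-bracket ceiling, `t–t'` class (PROVED below)** — the shape consumed by the
certified column (tree rows `tlUpper…`, `clusterLowerTL_…`, `tlLower…`, `windowLower…`).
kind: support (PROVED). Why it might fail: it cannot. -/
@[conjecture] def StiffnessCeilingFromEnergyDensityBracketsSharpTT' : Prop :=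
  ∀ (t' t₃ U U₁ δ ρs θ₀ : ℝ), t' ≤ 0 → t₃ < t' → 0 ≤ U₁ → U₁ < U → -1 < δ → δ ≤ 1 → 0 < ρs →
    0 < θ₀ →
    (∃ L₀ : ℕ, ∀ (L : ℕ) [NeZero L], L₀ ≤ L → Even L →
      ∀ θ : ℝ, |θ| ≤ θ₀ → ρs * θ ^ 2 ≤ fluxEnergyTT' L t' U δ θ - fluxEnergyTT' L t' U δ 0) →
    ∀ (r l₁ l₃ : ℝ), energyDensityTT' 1 t' U (1 - δ) ≤ r → l₁ ≤ energyDensityTT' 1 t' U₁ (1 - δ) →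
      l₃ ≤ energyDensityTT' 1 t₃ U (1 - δ) →
      ρs ≤ ((U₁ * r - U * l₁) / (U - U₁) + t' * ((r - l₃) / (t₃ - t'))) / 4

/-- **Proof of `StiffnessCeilingFromEnergyDensityBracketsSharpTT'`.** -/
theorem stiffnessCeilingFromEnergyDensityBracketsSharpTT'_holds :
    StiffnessCeilingFromEnergyDensityBracketsSharpTT' := by
  intro t' t₃ U U₁ δ ρs θ₀ ht' ht₃ hU₁ hU hδ1 hδ2 hρs hθ₀ hst r l₁ l₃ hr hl₁ hl₃
  obtain ⟨L₀, hst⟩ := hst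
  exact stiffnessTT'_le_of_energyDensityBrackets_sharp ht' ht₃ hU₁ hU hδ1 hδ2 hρs hθ₀ hst hr hl₁ hl₃

end Summit.HubbardSuperconductivity.HubbardLadder.Bounds

end
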